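import Summits.QuantumFields.BalabanUV.Beta.GAN24.T2DriftHalfMemberOfLetterRows
import Summits.QuantumFields.BalabanUV.Beta.GAN24.T2ShapeEvenMemberOfWardLetters
import Summits.QuantumFields.BalabanUV.Beta.GAN24.BlockCommutatorStepLetterDrift

/-!
# `BalabanUV.Beta.GAN24.T2DriftEvenMemberOfWardLetters` — binder row G-an2-4 ∕ (CONV-C), W-slot, the (α-0) parity re-cut, (α-END-c′) at the LETTER level, PART C:
# **«T2Drift^{ev}» AT D1's PIN FROM THE WARD LETTERS, TWO SCALAR ROWS, THE LEG ROWS AND (C) ONLY** — PART B `T2DriftHalfMemberOfLetterRows.rate_halfMember_three_of_letterRows`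
# at `ε = 1` with `S_l := SpureRecAt 3 Lc ρ cE cVH cΛ l`, `X := fun Y ↦ diagK (½ • Σ_{v∈box} legInd ρ (Lc•Y + v))` and FOUR displayed row groups DISCHARGED BY NAME: the S-slot rows
# `(hS, hSall)` by the OWNER gan24-p1 g22's `SrecAtSlotRowsFinal.exists_hS_hSall_SrecAt_three`, the S-step slot letters `hE₁ hE₂` by p2 g45's
# `BlockCommutatorStepLetter.exists_evenRows_uniform_three`, THEIR DRIFTS `hEd₁ hEd₂` by p2 g45's `BlockCommutatorStepLetterDrift.exists_evenRowsDrift_uniform_three`, the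
# commutator parity `hCm` by d1-leaf-05's `trK_SpureRecAt` ⨾ this lineage's `parityEven_comm_of_oddRows` — the drift twin of leaf-03 g66's FILE 3c `T2ShapeEvenMemberOfWardLetters`
# (G-an2-4 FORMAL swarm → CRUX TEAM (2), leaf-01 lineage `b2b-balaban-gan24-formalise-leaf-01`, gen 73; journal INTENT 2 [LEAF01-G73-INTENT2])

NOT IN PRINT; OUR BOOKKEEPING ([folklore] one composition BY NAME; 0 `def`, 0 cited facts, 0 `def … : Prop`, 0 sorry).  HONEST FRAMING (cell contract, verbatim): «discharging
`BetaPertH` makes Bałaban's UV stability UNCONDITIONAL — a real constructive-QFT result; it is NOT the continuum limit and NOT the Clay problem.»  HONEST DEPENDENCY (verbatim):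
«continuum YM on T⁴ ⇐ BetaPertH ∧ nine spine estimates (0/9 proved); BetaPertH ⇐ (D1) ∧ (D4) ∧ CAP+tail; G-an2-4 gates asym, D1 and NE2/3/4.»

WHAT (`d = 3`, `2 ≤ Lc`, in-block root `r`, PINS `hcE : cE = Lc⁴` and the EXACT `hpinEq : cE₂ = Lc^{2(3+1)}`, any `cVH cΛ cB Tc`, off-diagonal `Lc`-covariant `LocStencil₂` border):
**`t2DriftEven_three_of_wardLetters`** — «T2Drift^{ev}» (the OWNER's one-step drift ∧ Cauchy conclusion for `½ • (T♮̃_n + (1 : ℝ) • P T♮̃_n)`) and **`…_junction`** (spelling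
`½ • (T♮̃_n + P T♮̃_n)`, `one_smul`).  WHAT STAYS DISPLAYED — THE WHOLE LIST: the border rows; per level D1's RAW TABLE LAWS `hTL ∕ hTL″` with FREE parity-ODD residual words
`R R″` (`hR hR″`) and lock constants `cH` (`hcH0 : cH l ≠ 0`) — at the literal = `WardLocusQuarticTable.tableLaw_T2RecAt_succ ∕ _zero` under its Ward data; p2's two scalar rows
`hcH : |(sf_l·sm_l)⁻¹·(cH l)⁻¹| ≤ c₀` and `hq` (the lock scalar is `l`-free); THE TWO LEG ROWS `hL₁ hL₂` AND THEIR DRIFTS `hL₁′ hL₂′` = (Q-L) in letter currency; `hC` = (C)^{ev}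
(⟸ (C)sym by `RowCChargeForms.hC_halfMember_of_CSym_three` at `3 ≤ Lc`).  Discharges NOTHING of (Q-L) ∕ (C) ∕ (C)sym ∕ «T2Drift^{ev}» unconditionally ∕ (hW, hWall); NEVER
«G-an2-4 closed» as (CONV-C); NOT D1, NOT `BetaPertH`, NOT continuum, NOT Clay.  2026-08-23; no existing file touched.
-/

noncomputable section

open Finset
open scoped BigOperators
open Literature.MathematicalPhysics.QuantumFieldTheory
open Literature.MathematicalPhysics.QuantumFieldTheory.Balaban1983to89
open Literature.MathematicalPhysics.QuantumFieldTheory.Balaban1983to89.Beta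
open ExpKernelCalculus (MKer shiftK BiLoc Decays comp)
open OneStepResolventKernel (Fib LocStencil)
open OneStepKernelFamily (KInvStep)
open AffineAveraging (box toSite unitVec)
open AveragingMixedJetTables (mixFFAt)
open SecondOrderResponse (W2SymOfK)
open KernelWard (divV)
open BalabanCompositeJets (LocStencil₂)
open BalabanStepJetsSucc (mmRead)
open BalabanStepW2 (K3OfK M2Of)
open Summit.QuantumFields.BalabanUV.Beta.TameKernelCalculus (trK)
open Summit.QuantumFields.BalabanUV.Beta.BorderedHessian (sgnK diagK)
open Summit.QuantumFields.BalabanUV.Beta.AveragingWardRootedStencils (legInd)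
open Summit.QuantumFields.BalabanUV.Beta.HessKerDressedUnits (unitK unitS)
open Summit.QuantumFields.BalabanUV.Beta.SecondOrderUnits (unitM unitS₂ unitM₂)
open Summit.QuantumFields.BalabanUV.Beta.AxialDressingRooted (coDressKBmAt)
open Summit.QuantumFields.BalabanUV.Beta.SpineRooted (T2RecAt SpureRecAt M1At e3OfK)
open Summit.QuantumFields.BalabanUV.Beta.SpineRecursivePureParity (trK_SpureRecAt)
open Summit.QuantumFields.BalabanUV.Beta.GAN24.CombesThomas (sfStep smStep)
open Summit.QuantumFields.BalabanUV.Beta.GAN24.T2RecursionAffine (lin4)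
open Summit.QuantumFields.BalabanUV.Beta.GAN24.BiStencilZeroMode (zmode)
open Summit.QuantumFields.BalabanUV.Beta.GAN24.SrecAtSlotRowsFinal (exists_hS_hSall_SrecAt_three)
open Summit.QuantumFields.BalabanUV.Beta.GAN24.HalfMemberSlavedDivergence (parityEven_comm_of_oddRows)
open Summit.QuantumFields.BalabanUV.Beta.GAN24.BlockCommutatorStepLetter (exists_evenRows_uniform_three)
open Summit.QuantumFields.BalabanUV.Beta.GAN24.BlockCommutatorStepLetterDrift (exists_evenRowsDrift_uniform_three)
open Summit.QuantumFields.BalabanUV.Beta.GAN24.T2DriftHalfMemberOfLetterRows (rate_halfMember_three_of_letterRows)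

namespace Summit.QuantumFields.BalabanUV.Beta.GAN24.T2DriftEvenMemberOfWardLetters

variable {Lc : ℕ} [NeZero Lc] {r : Fin (3 + 1) → ℕ}

/-- NOT IN PRINT; OUR BOOKKEEPING.  **«T2Drift^{ev}» AT D1's PIN FROM THE WARD LETTERS, TWO SCALAR ROWS, THE LEG ROWS (AND DRIFTS) AND `hC`** (`d = 3`, `2 ≤ Lc`,
in-block root `r`, `cE = Lc⁴`, EXACT `cE₂ = Lc⁸`): PART B at `ε = 1` with `S_l := SpureRecAt 3 Lc ρ cE cVH cΛ l`, `X := fun Y ↦ diagK (½ • Σ_{v∈box} legInd ρ (Lc•Y + v))`,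
`(hS, hSall)` by `exists_hS_hSall_SrecAt_three`, `hE₁ hE₂` by `exists_evenRows_uniform_three`, `hEd₁ hEd₂` by `exists_evenRowsDrift_uniform_three` (both `.mono`'d to
`min δE δE′`), `hCm` by `trK_SpureRecAt` ⨾ `parityEven_comm_of_oddRows`.  DISPLAYED: border rows, the raw table laws `hTL hTL″` with free odd residuals `R R″` and locks `cH`,
p2's scalar rows `hcH hq`, the LEG rows `hL₁ hL₂ hL₁′ hL₂′` = (Q-L), `hC` = (C)^{ev}.  Nothing of (Q-L) ∕ (C) is discharged. -/
theorem t2DriftEven_three_of_wardLetters (hLc : 2 ≤ Lc) (hr : r ∈ box (3 + 1) Lc) (cE cVH cΛ cE₂ cB : ℝ) (hcE : cE = (Lc : ℝ) ^ (3 + 1))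
    (hpinEq : cE₂ = (Lc : ℝ) ^ (2 * (3 + 1))) (Tc : Fin 4 → Fin 4 → Fin 4 → Fin 4 → ℝ)
    {vh₂S : Fin (3 + 1) → (Fin (3 + 1) → ℤ) → Fin (3 + 1) → (Fin (3 + 1) → ℤ) → MKer (3 + 1) (Fib 3)}
    (hBff : ∀ κ u κ' u' x z (α β : Fin (3 + 1)), vh₂S κ u κ' u' x z (Sum.inl α) (Sum.inl β) = 0)
    (hBmm : ∀ κ u κ' u' x z (μ ν : Fin (3 + 1)), vh₂S κ u κ' u' x z (Sum.inr μ) (Sum.inr ν) = 0)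
    {CB δB : ℝ} (hB : LocStencil₂ vh₂S CB δB) (hδB : 0 < δB)
    (hBt : ∀ (κ : Fin (3 + 1)) (u : Fin (3 + 1) → ℤ) (κ' : Fin (3 + 1)) (u' t : Fin (3 + 1) → ℤ),
        vh₂S κ (u + (Lc : ℤ) • t) κ' (u' + (Lc : ℤ) • t) = shiftK (-((Lc : ℤ) • t)) (vh₂S κ u κ' u'))
     {R R'' : ℕ → (Fin (3 + 1) → ℤ) → Fin (3 + 1) → (Fin (3 + 1) → ℤ) → MKer (3 + 1) (Fib 3)} {cH : ℕ → ℝ} (hcH0 : ∀ l, cH l ≠ 0) {c₀ : ℝ}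
    (hcH : ∀ l, |(sfStep Lc l * smStep 3 Lc l)⁻¹ * (cH l)⁻¹| ≤ c₀)
    (hTL : ∀ (l : ℕ) (Y : Fin (3 + 1) → ℤ) (κ' : Fin (3 + 1)) (u' : Fin (3 + 1) → ℤ),
      cH l • ∑ v ∈ box (3 + 1) Lc, divV (fun κ u => T2RecAt 3 Lc (toSite r) cE cVH cΛ cE₂ cB Tc vh₂S (mixFFAt (toSite r) Lc) l κ u κ' u') ((Lc : ℤ) • Y + toSite v)
        = comp (SpureRecAt 3 Lc (toSite r) cE cVH cΛ l κ' u') (diagK (((1 : ℝ) / 2) • ∑ v ∈ box (3 + 1) Lc, legInd (toSite r) ((Lc : ℤ) • Y + toSite v))) - comp (diagK (((1 : ℝ) / 2) • ∑ v ∈ box (3 + 1) Lc, legInd (toSite r) ((Lc : ℤ) • Y + toSite v))) (SpureRecAt 3 Lc (toSite r) cE cVH cΛ l κ' u') + R l Y κ' u')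
    (hTL'' : ∀ (l : ℕ) (Y : Fin (3 + 1) → ℤ) (κ : Fin (3 + 1)) (u : Fin (3 + 1) → ℤ),
      cH l • ∑ v ∈ box (3 + 1) Lc, divV (T2RecAt 3 Lc (toSite r) cE cVH cΛ cE₂ cB Tc vh₂S (mixFFAt (toSite r) Lc) l κ u) ((Lc : ℤ) • Y + toSite v)
        = comp (SpureRecAt 3 Lc (toSite r) cE cVH cΛ l κ u) (diagK (((1 : ℝ) / 2) • ∑ v ∈ box (3 + 1) Lc, legInd (toSite r) ((Lc : ℤ) • Y + toSite v))) - comp (diagK (((1 : ℝ) / 2) • ∑ v ∈ box (3 + 1) Lc, legInd (toSite r) ((Lc : ℤ) • Y + toSite v))) (SpureRecAt 3 Lc (toSite r) cE cVH cΛ l κ u) + R'' l Y κ u)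
    (hR : ∀ (l : ℕ) (Y : Fin (3 + 1) → ℤ) (κ : Fin (3 + 1)) (u : Fin (3 + 1) → ℤ), trK (R l Y κ u) = -sgnK (R l Y κ u))
    (hR'' : ∀ (l : ℕ) (Y : Fin (3 + 1) → ℤ) (κ : Fin (3 + 1)) (u : Fin (3 + 1) → ℤ), trK (R'' l Y κ u) = -sgnK (R'' l Y κ u))
    (hq : ∀ l, (sfStep Lc (l + 1) * smStep 3 Lc (l + 1))⁻¹ * (cH (l + 1))⁻¹ = (sfStep Lc l * smStep 3 Lc l)⁻¹ * (cH l)⁻¹)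
    {CL₁ CL₂ CL₁' CL₂' θL δ : ℝ} (hδ : 0 < δ) (hθL0 : 0 ≤ θL) (hθL1 : θL < 1)
    (hL₁ : ∀ l, LocStencil₂ (fun κ u κ' u' => fun (p z : Fin (3 + 1) → ℤ) (_ : Fib 3) (b : Fib 3) =>
      ∑ β : Fin (3 + 1), ((((1 : ℝ) / 2) • (unitS₂ (sfStep Lc l) (smStep 3 Lc l) (T2RecAt 3 Lc (toSite r) cE cVH cΛ cE₂ cB Tc vh₂S (mixFFAt (toSite r) Lc) l)
        + (1 : ℝ) • fun κ u κ' u' => sgnK (trK ((unitS₂ (sfStep Lc l) (smStep 3 Lc l) (T2RecAt 3 Lc (toSite r) cE cVH cΛ cE₂ cB Tc vh₂S (mixFFAt (toSite r) Lc) l))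
          κ u κ' u')))) κ u κ' u' p z (Sum.inl β) b
        - (((1 : ℝ) / 2) • (unitS₂ (sfStep Lc l) (smStep 3 Lc l) (T2RecAt 3 Lc (toSite r) cE cVH cΛ cE₂ cB Tc vh₂S (mixFFAt (toSite r) Lc) l)
        + (1 : ℝ) • fun κ u κ' u' => sgnK (trK ((unitS₂ (sfStep Lc l) (smStep 3 Lc l) (T2RecAt 3 Lc (toSite r) cE cVH cΛ cE₂ cB Tc vh₂S (mixFFAt (toSite r) Lc) l))
          κ u κ' u')))) κ u κ' u' (p - unitVec β) z (Sum.inl β) b)) CL₁ δ)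
    (hL₂ : ∀ l, LocStencil₂ (fun κ u κ' u' => fun (x p : Fin (3 + 1) → ℤ) (a : Fib 3) (_ : Fib 3) =>
      ∑ β : Fin (3 + 1), ((((1 : ℝ) / 2) • (unitS₂ (sfStep Lc l) (smStep 3 Lc l) (T2RecAt 3 Lc (toSite r) cE cVH cΛ cE₂ cB Tc vh₂S (mixFFAt (toSite r) Lc) l)
        + (1 : ℝ) • fun κ u κ' u' => sgnK (trK ((unitS₂ (sfStep Lc l) (smStep 3 Lc l) (T2RecAt 3 Lc (toSite r) cE cVH cΛ cE₂ cB Tc vh₂S (mixFFAt (toSite r) Lc) l))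
          κ u κ' u')))) κ u κ' u' x p a (Sum.inl β)
        - (((1 : ℝ) / 2) • (unitS₂ (sfStep Lc l) (smStep 3 Lc l) (T2RecAt 3 Lc (toSite r) cE cVH cΛ cE₂ cB Tc vh₂S (mixFFAt (toSite r) Lc) l)
        + (1 : ℝ) • fun κ u κ' u' => sgnK (trK ((unitS₂ (sfStep Lc l) (smStep 3 Lc l) (T2RecAt 3 Lc (toSite r) cE cVH cΛ cE₂ cB Tc vh₂S (mixFFAt (toSite r) Lc) l))
          κ u κ' u')))) κ u κ' u' x (p - unitVec β) a (Sum.inl β))) CL₂ δ)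
    (hL₁' : ∀ l, LocStencil₂ (fun κ u κ' u' => fun (p z : Fin (3 + 1) → ℤ) (_ : Fib 3) (b : Fib 3) =>
      ∑ β : Fin (3 + 1), (((((1 : ℝ) / 2) • (unitS₂ (sfStep Lc (l + 1)) (smStep 3 Lc (l + 1)) (T2RecAt 3 Lc (toSite r) cE cVH cΛ cE₂ cB Tc vh₂S (mixFFAt (toSite r) Lc) (l + 1))
        + (1 : ℝ) • fun κ u κ' u' => sgnK (trK ((unitS₂ (sfStep Lc (l + 1)) (smStep 3 Lc (l + 1)) (T2RecAt 3 Lc (toSite r) cE cVH cΛ cE₂ cB Tc vh₂S (mixFFAt (toSite r) Lc) (l + 1)))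
          κ u κ' u'))))
        - (((1 : ℝ) / 2) • (unitS₂ (sfStep Lc l) (smStep 3 Lc l) (T2RecAt 3 Lc (toSite r) cE cVH cΛ cE₂ cB Tc vh₂S (mixFFAt (toSite r) Lc) l)
        + (1 : ℝ) • fun κ u κ' u' => sgnK (trK ((unitS₂ (sfStep Lc l) (smStep 3 Lc l) (T2RecAt 3 Lc (toSite r) cE cVH cΛ cE₂ cB Tc vh₂S (mixFFAt (toSite r) Lc) l))
          κ u κ' u'))))) κ u κ' u' p z (Sum.inl β) b
        - ((((1 : ℝ) / 2) • (unitS₂ (sfStep Lc (l + 1)) (smStep 3 Lc (l + 1)) (T2RecAt 3 Lc (toSite r) cE cVH cΛ cE₂ cB Tc vh₂S (mixFFAt (toSite r) Lc) (l + 1))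
        + (1 : ℝ) • fun κ u κ' u' => sgnK (trK ((unitS₂ (sfStep Lc (l + 1)) (smStep 3 Lc (l + 1)) (T2RecAt 3 Lc (toSite r) cE cVH cΛ cE₂ cB Tc vh₂S (mixFFAt (toSite r) Lc) (l + 1)))
          κ u κ' u'))))
        - (((1 : ℝ) / 2) • (unitS₂ (sfStep Lc l) (smStep 3 Lc l) (T2RecAt 3 Lc (toSite r) cE cVH cΛ cE₂ cB Tc vh₂S (mixFFAt (toSite r) Lc) l)
        + (1 : ℝ) • fun κ u κ' u' => sgnK (trK ((unitS₂ (sfStep Lc l) (smStep 3 Lc l) (T2RecAt 3 Lc (toSite r) cE cVH cΛ cE₂ cB Tc vh₂S (mixFFAt (toSite r) Lc) l))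
          κ u κ' u'))))) κ u κ' u' (p - unitVec β) z (Sum.inl β) b)) (CL₁' * θL ^ l) δ)
    (hL₂' : ∀ l, LocStencil₂ (fun κ u κ' u' => fun (x p : Fin (3 + 1) → ℤ) (a : Fib 3) (_ : Fib 3) =>
      ∑ β : Fin (3 + 1), (((((1 : ℝ) / 2) • (unitS₂ (sfStep Lc (l + 1)) (smStep 3 Lc (l + 1)) (T2RecAt 3 Lc (toSite r) cE cVH cΛ cE₂ cB Tc vh₂S (mixFFAt (toSite r) Lc) (l + 1))
        + (1 : ℝ) • fun κ u κ' u' => sgnK (trK ((unitS₂ (sfStep Lc (l + 1)) (smStep 3 Lc (l + 1)) (T2RecAt 3 Lc (toSite r) cE cVH cΛ cE₂ cB Tc vh₂S (mixFFAt (toSite r) Lc) (l + 1)))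
          κ u κ' u'))))
        - (((1 : ℝ) / 2) • (unitS₂ (sfStep Lc l) (smStep 3 Lc l) (T2RecAt 3 Lc (toSite r) cE cVH cΛ cE₂ cB Tc vh₂S (mixFFAt (toSite r) Lc) l)
        + (1 : ℝ) • fun κ u κ' u' => sgnK (trK ((unitS₂ (sfStep Lc l) (smStep 3 Lc l) (T2RecAt 3 Lc (toSite r) cE cVH cΛ cE₂ cB Tc vh₂S (mixFFAt (toSite r) Lc) l))
          κ u κ' u'))))) κ u κ' u' x p a (Sum.inl β)
        - ((((1 : ℝ) / 2) • (unitS₂ (sfStep Lc (l + 1)) (smStep 3 Lc (l + 1)) (T2RecAt 3 Lc (toSite r) cE cVH cΛ cE₂ cB Tc vh₂S (mixFFAt (toSite r) Lc) (l + 1))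
        + (1 : ℝ) • fun κ u κ' u' => sgnK (trK ((unitS₂ (sfStep Lc (l + 1)) (smStep 3 Lc (l + 1)) (T2RecAt 3 Lc (toSite r) cE cVH cΛ cE₂ cB Tc vh₂S (mixFFAt (toSite r) Lc) (l + 1)))
          κ u κ' u'))))
        - (((1 : ℝ) / 2) • (unitS₂ (sfStep Lc l) (smStep 3 Lc l) (T2RecAt 3 Lc (toSite r) cE cVH cΛ cE₂ cB Tc vh₂S (mixFFAt (toSite r) Lc) l)
        + (1 : ℝ) • fun κ u κ' u' => sgnK (trK ((unitS₂ (sfStep Lc l) (smStep 3 Lc l) (T2RecAt 3 Lc (toSite r) cE cVH cΛ cE₂ cB Tc vh₂S (mixFFAt (toSite r) Lc) l))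
          κ u κ' u'))))) κ u κ' u' x (p - unitVec β) a (Sum.inl β))) (CL₂' * θL ^ l) δ)
    (hC : ∀ l, (∀ κ κ' κ₁ κ₂, zmode Lc (((1 : ℝ) / 2) • ((fun κ u κ' u' => (cE₂ * (Lc : ℝ) ^ (2 * (3 + 1))) • mmRead Lc (K3OfK (unitK (sfStep Lc l) (smStep 3 Lc l) (coDressKBmAt (toSite r) Lc (KInvStep (d :=
        3) Lc l))) Lc (unitS (sfStep Lc l) (smStep 3 Lc l) (SpureRecAt 3 Lc (toSite r) cE cVH cΛ l)) (unitM (sfStep Lc l) (smStep 3 Lc l) (M1At 3 Lc (toSite r) cΛ l)) (W2SymOfK (unitK (sfStep Lc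
        l) (smStep 3 Lc l) (coDressKBmAt (toSite r) Lc (KInvStep (d := 3) Lc l))) Lc (unitS (sfStep Lc l) (smStep 3 Lc l) (SpureRecAt 3 Lc (toSite r) cE cVH cΛ l)) (unitM (sfStep Lc l) (smStep 3
        Lc l) (M1At 3 Lc (toSite r) cΛ l)) 0 (unitM₂ (sfStep Lc l) (smStep 3 Lc l) (M2Of 3 Lc (mixFFAt (toSite r) Lc) l))) κ u κ' u') + cB • vh₂S κ u κ' u') + (1 : ℝ) • fun κ u κ' u' => sgnK (trK
        ((cE₂ * (Lc : ℝ) ^ (2 * (3 + 1))) • mmRead Lc (K3OfK (unitK (sfStep Lc l) (smStep 3 Lc l) (coDressKBmAt (toSite r) Lc (KInvStep (d := 3) Lc l))) Lc (unitS (sfStep Lc l) (smStep 3 Lc l)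
        (SpureRecAt 3 Lc (toSite r) cE cVH cΛ l)) (unitM (sfStep Lc l) (smStep 3 Lc l) (M1At 3 Lc (toSite r) cΛ l)) (W2SymOfK (unitK (sfStep Lc l) (smStep 3 Lc l) (coDressKBmAt (toSite r) Lc
        (KInvStep (d := 3) Lc l))) Lc (unitS (sfStep Lc l) (smStep 3 Lc l) (SpureRecAt 3 Lc (toSite r) cE cVH cΛ l)) (unitM (sfStep Lc l) (smStep 3 Lc l) (M1At 3 Lc (toSite r) cΛ l)) 0 (unitM₂
        (sfStep Lc l) (smStep 3 Lc l) (M2Of 3 Lc (mixFFAt (toSite r) Lc) l))) κ u κ' u') + cB • vh₂S κ u κ' u'))) + (lin4 (cE₂ * (Lc : ℝ) ^ (2 * (3 + 1))) (unitK (sfStep Lc l) (smStep 3 Lc l)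
        (coDressKBmAt (toSite r) Lc (KInvStep (d := 3) Lc l))) Lc (((1 : ℝ) / 2) • (unitS₂ (sfStep Lc l) (smStep 3 Lc l) (T2RecAt 3 Lc (toSite r) cE cVH cΛ cE₂ cB Tc vh₂S (mixFFAt (toSite r) Lc)
        l) + (1 : ℝ) • fun κ u κ' u' => sgnK (trK ((unitS₂ (sfStep Lc l) (smStep 3 Lc l) (T2RecAt 3 Lc (toSite r) cE cVH cΛ cE₂ cB Tc vh₂S (mixFFAt (toSite r) Lc) l)) κ u κ' u')))) - lin4 (cE₂ * (Lc :
        ℝ) ^ (2 * (3 + 1))) (unitK (sfStep Lc l) (smStep 3 Lc l) (KInvStep (d := 3) Lc l)) Lc (((1 : ℝ) / 2) • (unitS₂ (sfStep Lc l) (smStep 3 Lc l) (T2RecAt 3 Lc (toSite r) cE cVH cΛ cE₂ cB Tc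
        vh₂S (mixFFAt (toSite r) Lc) l) + (1 : ℝ) • fun κ u κ' u' => sgnK (trK ((unitS₂ (sfStep Lc l) (smStep 3 Lc l) (T2RecAt 3 Lc (toSite r) cE cVH cΛ cE₂ cB Tc vh₂S (mixFFAt (toSite r) Lc) l)) κ u
        κ' u')))))) κ κ' (Sum.inl κ₁) (Sum.inl κ₂) + zmode Lc (((1 : ℝ) / 2) • ((fun κ u κ' u' => (cE₂ * (Lc : ℝ) ^ (2 * (3 + 1))) • mmRead Lc (K3OfK (unitK (sfStep Lc l) (smStep 3 Lc l)
        (coDressKBmAt (toSite r) Lc (KInvStep (d := 3) Lc l))) Lc (unitS (sfStep Lc l) (smStep 3 Lc l) (SpureRecAt 3 Lc (toSite r) cE cVH cΛ l)) (unitM (sfStep Lc l) (smStep 3 Lc l) (M1At 3 Lc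
        (toSite r) cΛ l)) (W2SymOfK (unitK (sfStep Lc l) (smStep 3 Lc l) (coDressKBmAt (toSite r) Lc (KInvStep (d := 3) Lc l))) Lc (unitS (sfStep Lc l) (smStep 3 Lc l) (SpureRecAt 3 Lc (toSite
        r) cE cVH cΛ l)) (unitM (sfStep Lc l) (smStep 3 Lc l) (M1At 3 Lc (toSite r) cΛ l)) 0 (unitM₂ (sfStep Lc l) (smStep 3 Lc l) (M2Of 3 Lc (mixFFAt (toSite r) Lc) l))) κ u κ' u') + cB • vh₂S
        κ u κ' u') + (1 : ℝ) • fun κ u κ' u' => sgnK (trK ((cE₂ * (Lc : ℝ) ^ (2 * (3 + 1))) • mmRead Lc (K3OfK (unitK (sfStep Lc l) (smStep 3 Lc l) (coDressKBmAt (toSite r) Lc (KInvStep (d := 3) Lc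
        l))) Lc (unitS (sfStep Lc l) (smStep 3 Lc l) (SpureRecAt 3 Lc (toSite r) cE cVH cΛ l)) (unitM (sfStep Lc l) (smStep 3 Lc l) (M1At 3 Lc (toSite r) cΛ l)) (W2SymOfK (unitK (sfStep Lc l)
        (smStep 3 Lc l) (coDressKBmAt (toSite r) Lc (KInvStep (d := 3) Lc l))) Lc (unitS (sfStep Lc l) (smStep 3 Lc l) (SpureRecAt 3 Lc (toSite r) cE cVH cΛ l)) (unitM (sfStep Lc l) (smStep 3 Lc
        l) (M1At 3 Lc (toSite r) cΛ l)) 0 (unitM₂ (sfStep Lc l) (smStep 3 Lc l) (M2Of 3 Lc (mixFFAt (toSite r) Lc) l))) κ u κ' u') + cB • vh₂S κ u κ' u'))) + (lin4 (cE₂ * (Lc : ℝ) ^ (2 * (3 +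
        1))) (unitK (sfStep Lc l) (smStep 3 Lc l) (coDressKBmAt (toSite r) Lc (KInvStep (d := 3) Lc l))) Lc (((1 : ℝ) / 2) • (unitS₂ (sfStep Lc l) (smStep 3 Lc l) (T2RecAt 3 Lc (toSite r) cE cVH
        cΛ cE₂ cB Tc vh₂S (mixFFAt (toSite r) Lc) l) + (1 : ℝ) • fun κ u κ' u' => sgnK (trK ((unitS₂ (sfStep Lc l) (smStep 3 Lc l) (T2RecAt 3 Lc (toSite r) cE cVH cΛ cE₂ cB Tc vh₂S (mixFFAt (toSite r)
        Lc) l)) κ u κ' u')))) - lin4 (cE₂ * (Lc : ℝ) ^ (2 * (3 + 1))) (unitK (sfStep Lc l) (smStep 3 Lc l) (KInvStep (d := 3) Lc l)) Lc (((1 : ℝ) / 2) • (unitS₂ (sfStep Lc l) (smStep 3 Lc l)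
        (T2RecAt 3 Lc (toSite r) cE cVH cΛ cE₂ cB Tc vh₂S (mixFFAt (toSite r) Lc) l) + (1 : ℝ) • fun κ u κ' u' => sgnK (trK ((unitS₂ (sfStep Lc l) (smStep 3 Lc l) (T2RecAt 3 Lc (toSite r) cE cVH cΛ
        cE₂ cB Tc vh₂S (mixFFAt (toSite r) Lc) l)) κ u κ' u')))))) κ' κ (Sum.inl κ₁) (Sum.inl κ₂) = 0)) :
    ∃ c ϑ δ : ℝ, 0 ≤ c ∧ 0 < ϑ ∧ ϑ < 1 ∧ 0 < δ ∧
      (∀ n, LocStencil₂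
        ((((1 : ℝ) / 2) • (unitS₂ (sfStep Lc (n + 1)) (smStep 3 Lc (n + 1)) (T2RecAt 3 Lc (toSite r) cE cVH cΛ cE₂ cB Tc vh₂S (mixFFAt (toSite r) Lc) (n + 1)) + (1 : ℝ) • fun κ u κ' u' => sgnK (trK ((unitS₂
          (sfStep Lc (n + 1)) (smStep 3 Lc (n + 1)) (T2RecAt 3 Lc (toSite r) cE cVH cΛ cE₂ cB Tc vh₂S (mixFFAt (toSite r) Lc) (n + 1))) κ u κ' u')))) -
         (((1 : ℝ) / 2) • (unitS₂ (sfStep Lc n) (smStep 3 Lc n) (T2RecAt 3 Lc (toSite r) cE cVH cΛ cE₂ cB Tc vh₂S (mixFFAt (toSite r) Lc) n) + (1 : ℝ) • fun κ u κ' u' => sgnK (trK ((unitS₂ (sfStep Lc n)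
          (smStep 3 Lc n) (T2RecAt 3 Lc (toSite r) cE cVH cΛ cE₂ cB Tc vh₂S (mixFFAt (toSite r) Lc) n)) κ u κ' u'))))) (c * ϑ ^ n) δ) ∧
      (∀ k j, LocStencil₂
        ((((1 : ℝ) / 2) • (unitS₂ (sfStep Lc (k + j)) (smStep 3 Lc (k + j)) (T2RecAt 3 Lc (toSite r) cE cVH cΛ cE₂ cB Tc vh₂S (mixFFAt (toSite r) Lc) (k + j)) + (1 : ℝ) • fun κ u κ' u' => sgnK (trK ((unitS₂
          (sfStep Lc (k + j)) (smStep 3 Lc (k + j)) (T2RecAt 3 Lc (toSite r) cE cVH cΛ cE₂ cB Tc vh₂S (mixFFAt (toSite r) Lc) (k + j))) κ u κ' u')))) -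
         (((1 : ℝ) / 2) • (unitS₂ (sfStep Lc k) (smStep 3 Lc k) (T2RecAt 3 Lc (toSite r) cE cVH cΛ cE₂ cB Tc vh₂S (mixFFAt (toSite r) Lc) k) + (1 : ℝ) • fun κ u κ' u' => sgnK (trK ((unitS₂ (sfStep Lc k)
          (smStep 3 Lc k) (T2RecAt 3 Lc (toSite r) cE cVH cΛ cE₂ cB Tc vh₂S (mixFFAt (toSite r) Lc) k)) κ u κ' u'))))) (c * (1 - ϑ)⁻¹ * ϑ ^ k) δ) := by
  have hLc1 : 1 ≤ Lc := le_trans (by norm_num) hLc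
  -- the S-slot rows at the pin (the OWNER g22), hypothesis-free
  obtain ⟨Cs, cS, θS, δS, hθS0, hθS1, hδS, hall⟩ := exists_hS_hSall_SrecAt_three hLc hcE cVH cΛ
  obtain ⟨hS, hSall⟩ := hall r hr
  -- the two S-step slot letter rows at `ε = 1`, all levels, one constant (p2 g45), and their one-step drifts (p2 g45's drift twin)
  obtain ⟨CE, δE, hδE, hE⟩ := exists_evenRows_uniform_three (Lc := Lc) hLc hcE hr cVH cΛ
    (cE₂ * (Lc : ℝ) ^ (2 * (3 + 1)) * ((Lc : ℝ) ^ (3 + 1))⁻¹ / 2) cH hcH R R''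
  obtain ⟨CEd, θE, δE', hθE0, hθE1, hδE', hEd⟩ := exists_evenRowsDrift_uniform_three (Lc := Lc) hLc hcE hr cVH cΛ
    (cE₂ * (Lc : ℝ) ^ (2 * (3 + 1)) * ((Lc : ℝ) ^ (3 + 1))⁻¹ / 2) cH hcH hq R R''
  have hδEE : 0 < min δE δE' := lt_min hδE hδE'
  -- the commutator word of the odd-rowed first-order table with the diagonal generators is parity-even (d1-leaf-05 ⨾ this lineage)
  have hCm : ∀ (l : ℕ) (Y : Fin (3 + 1) → ℤ) (κ : Fin (3 + 1)) (u : Fin (3 + 1) → ℤ),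
      trK (comp (SpureRecAt 3 Lc (toSite r) cE cVH cΛ l κ u) (diagK (((1 : ℝ) / 2) • ∑ v ∈ box (3 + 1) Lc, legInd (toSite r) ((Lc : ℤ) • Y + toSite v)))
          - comp (diagK (((1 : ℝ) / 2) • ∑ v ∈ box (3 + 1) Lc, legInd (toSite r) ((Lc : ℤ) • Y + toSite v))) (SpureRecAt 3 Lc (toSite r) cE cVH cΛ l κ u))
        = sgnK (comp (SpureRecAt 3 Lc (toSite r) cE cVH cΛ l κ u) (diagK (((1 : ℝ) / 2) • ∑ v ∈ box (3 + 1) Lc, legInd (toSite r) ((Lc : ℤ) • Y + toSite v)))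
          - comp (diagK (((1 : ℝ) / 2) • ∑ v ∈ box (3 + 1) Lc, legInd (toSite r) ((Lc : ℤ) • Y + toSite v))) (SpureRecAt 3 Lc (toSite r) cE cVH cΛ l κ u)) :=
    fun l Y κ u => parityEven_comm_of_oddRows (fun κ u => trK_SpureRecAt hLc1 hr cE cVH cΛ l κ u)
      (fun Y => ((1 : ℝ) / 2) • ∑ v ∈ box (3 + 1) Lc, legInd (toSite r) ((Lc : ℤ) • Y + toSite v)) Y κ u
  exact rate_halfMember_three_of_letterRows (S := fun l => SpureRecAt 3 Lc (toSite r) cE cVH cΛ l)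
    (X := fun Y => diagK (((1 : ℝ) / 2) • ∑ v ∈ box (3 + 1) Lc, legInd (toSite r) ((Lc : ℤ) • Y + toSite v)))
    hLc hr cE cVH cΛ cE₂ cB hpinEq Tc hBff hBmm hB hδB hBt hS hSall hδS hθS0 hθS1 1 (by norm_num) hcH0 hTL hTL'' hCm hR hR'' hδEE
    (fun l => ((hE l).1).mono (min_le_left _ _)) (fun l => ((hE l).2).mono (min_le_left _ _)) hθE0 hθE1
    (fun l => ((hEd l).1).mono (min_le_right _ _)) (fun l => ((hEd l).2).mono (min_le_right _ _)) hδ hθL0 hθL1 hL₁ hL₂ hL₁' hL₂' hC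

/-- NOT IN PRINT; OUR BOOKKEEPING.  **THE SAME, JUNCTION SPELLING** `½ • (T♮̃_n + P T♮̃_n)` (p2 g44's `one_smul` bridge; the spelling of the OWNER's
`t2DriftEven_three_of_rows` and of p2 g45's capstone `hT₂d`). -/
theorem t2DriftEven_three_of_wardLetters_junction (hLc : 2 ≤ Lc) (hr : r ∈ box (3 + 1) Lc) (cE cVH cΛ cE₂ cB : ℝ) (hcE : cE = (Lc : ℝ) ^ (3 + 1))
    (hpinEq : cE₂ = (Lc : ℝ) ^ (2 * (3 + 1))) (Tc : Fin 4 → Fin 4 → Fin 4 → Fin 4 → ℝ)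
    {vh₂S : Fin (3 + 1) → (Fin (3 + 1) → ℤ) → Fin (3 + 1) → (Fin (3 + 1) → ℤ) → MKer (3 + 1) (Fib 3)}
    (hBff : ∀ κ u κ' u' x z (α β : Fin (3 + 1)), vh₂S κ u κ' u' x z (Sum.inl α) (Sum.inl β) = 0)
    (hBmm : ∀ κ u κ' u' x z (μ ν : Fin (3 + 1)), vh₂S κ u κ' u' x z (Sum.inr μ) (Sum.inr ν) = 0)
    {CB δB : ℝ} (hB : LocStencil₂ vh₂S CB δB) (hδB : 0 < δB)
    (hBt : ∀ (κ : Fin (3 + 1)) (u : Fin (3 + 1) → ℤ) (κ' : Fin (3 + 1)) (u' t : Fin (3 + 1) → ℤ),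
        vh₂S κ (u + (Lc : ℤ) • t) κ' (u' + (Lc : ℤ) • t) = shiftK (-((Lc : ℤ) • t)) (vh₂S κ u κ' u'))
     {R R'' : ℕ → (Fin (3 + 1) → ℤ) → Fin (3 + 1) → (Fin (3 + 1) → ℤ) → MKer (3 + 1) (Fib 3)} {cH : ℕ → ℝ} (hcH0 : ∀ l, cH l ≠ 0) {c₀ : ℝ}
    (hcH : ∀ l, |(sfStep Lc l * smStep 3 Lc l)⁻¹ * (cH l)⁻¹| ≤ c₀)
    (hTL : ∀ (l : ℕ) (Y : Fin (3 + 1) → ℤ) (κ' : Fin (3 + 1)) (u' : Fin (3 + 1) → ℤ),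
      cH l • ∑ v ∈ box (3 + 1) Lc, divV (fun κ u => T2RecAt 3 Lc (toSite r) cE cVH cΛ cE₂ cB Tc vh₂S (mixFFAt (toSite r) Lc) l κ u κ' u') ((Lc : ℤ) • Y + toSite v)
        = comp (SpureRecAt 3 Lc (toSite r) cE cVH cΛ l κ' u') (diagK (((1 : ℝ) / 2) • ∑ v ∈ box (3 + 1) Lc, legInd (toSite r) ((Lc : ℤ) • Y + toSite v))) - comp (diagK (((1 : ℝ) / 2) • ∑ v ∈ box (3 + 1) Lc, legInd (toSite r) ((Lc : ℤ) • Y + toSite v))) (SpureRecAt 3 Lc (toSite r) cE cVH cΛ l κ' u') + R l Y κ' u')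
    (hTL'' : ∀ (l : ℕ) (Y : Fin (3 + 1) → ℤ) (κ : Fin (3 + 1)) (u : Fin (3 + 1) → ℤ),
      cH l • ∑ v ∈ box (3 + 1) Lc, divV (T2RecAt 3 Lc (toSite r) cE cVH cΛ cE₂ cB Tc vh₂S (mixFFAt (toSite r) Lc) l κ u) ((Lc : ℤ) • Y + toSite v)
        = comp (SpureRecAt 3 Lc (toSite r) cE cVH cΛ l κ u) (diagK (((1 : ℝ) / 2) • ∑ v ∈ box (3 + 1) Lc, legInd (toSite r) ((Lc : ℤ) • Y + toSite v))) - comp (diagK (((1 : ℝ) / 2) • ∑ v ∈ box (3 + 1) Lc, legInd (toSite r) ((Lc : ℤ) • Y + toSite v))) (SpureRecAt 3 Lc (toSite r) cE cVH cΛ l κ u) + R'' l Y κ u)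
    (hR : ∀ (l : ℕ) (Y : Fin (3 + 1) → ℤ) (κ : Fin (3 + 1)) (u : Fin (3 + 1) → ℤ), trK (R l Y κ u) = -sgnK (R l Y κ u))
    (hR'' : ∀ (l : ℕ) (Y : Fin (3 + 1) → ℤ) (κ : Fin (3 + 1)) (u : Fin (3 + 1) → ℤ), trK (R'' l Y κ u) = -sgnK (R'' l Y κ u))
    (hq : ∀ l, (sfStep Lc (l + 1) * smStep 3 Lc (l + 1))⁻¹ * (cH (l + 1))⁻¹ = (sfStep Lc l * smStep 3 Lc l)⁻¹ * (cH l)⁻¹)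
    {CL₁ CL₂ CL₁' CL₂' θL δ : ℝ} (hδ : 0 < δ) (hθL0 : 0 ≤ θL) (hθL1 : θL < 1)
    (hL₁ : ∀ l, LocStencil₂ (fun κ u κ' u' => fun (p z : Fin (3 + 1) → ℤ) (_ : Fib 3) (b : Fib 3) =>
      ∑ β : Fin (3 + 1), ((((1 : ℝ) / 2) • (unitS₂ (sfStep Lc l) (smStep 3 Lc l) (T2RecAt 3 Lc (toSite r) cE cVH cΛ cE₂ cB Tc vh₂S (mixFFAt (toSite r) Lc) l)
        + (1 : ℝ) • fun κ u κ' u' => sgnK (trK ((unitS₂ (sfStep Lc l) (smStep 3 Lc l) (T2RecAt 3 Lc (toSite r) cE cVH cΛ cE₂ cB Tc vh₂S (mixFFAt (toSite r) Lc) l))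
          κ u κ' u')))) κ u κ' u' p z (Sum.inl β) b
        - (((1 : ℝ) / 2) • (unitS₂ (sfStep Lc l) (smStep 3 Lc l) (T2RecAt 3 Lc (toSite r) cE cVH cΛ cE₂ cB Tc vh₂S (mixFFAt (toSite r) Lc) l)
        + (1 : ℝ) • fun κ u κ' u' => sgnK (trK ((unitS₂ (sfStep Lc l) (smStep 3 Lc l) (T2RecAt 3 Lc (toSite r) cE cVH cΛ cE₂ cB Tc vh₂S (mixFFAt (toSite r) Lc) l))
          κ u κ' u')))) κ u κ' u' (p - unitVec β) z (Sum.inl β) b)) CL₁ δ)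
    (hL₂ : ∀ l, LocStencil₂ (fun κ u κ' u' => fun (x p : Fin (3 + 1) → ℤ) (a : Fib 3) (_ : Fib 3) =>
      ∑ β : Fin (3 + 1), ((((1 : ℝ) / 2) • (unitS₂ (sfStep Lc l) (smStep 3 Lc l) (T2RecAt 3 Lc (toSite r) cE cVH cΛ cE₂ cB Tc vh₂S (mixFFAt (toSite r) Lc) l)
        + (1 : ℝ) • fun κ u κ' u' => sgnK (trK ((unitS₂ (sfStep Lc l) (smStep 3 Lc l) (T2RecAt 3 Lc (toSite r) cE cVH cΛ cE₂ cB Tc vh₂S (mixFFAt (toSite r) Lc) l))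
          κ u κ' u')))) κ u κ' u' x p a (Sum.inl β)
        - (((1 : ℝ) / 2) • (unitS₂ (sfStep Lc l) (smStep 3 Lc l) (T2RecAt 3 Lc (toSite r) cE cVH cΛ cE₂ cB Tc vh₂S (mixFFAt (toSite r) Lc) l)
        + (1 : ℝ) • fun κ u κ' u' => sgnK (trK ((unitS₂ (sfStep Lc l) (smStep 3 Lc l) (T2RecAt 3 Lc (toSite r) cE cVH cΛ cE₂ cB Tc vh₂S (mixFFAt (toSite r) Lc) l))
          κ u κ' u')))) κ u κ' u' x (p - unitVec β) a (Sum.inl β))) CL₂ δ)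
    (hL₁' : ∀ l, LocStencil₂ (fun κ u κ' u' => fun (p z : Fin (3 + 1) → ℤ) (_ : Fib 3) (b : Fib 3) =>
      ∑ β : Fin (3 + 1), (((((1 : ℝ) / 2) • (unitS₂ (sfStep Lc (l + 1)) (smStep 3 Lc (l + 1)) (T2RecAt 3 Lc (toSite r) cE cVH cΛ cE₂ cB Tc vh₂S (mixFFAt (toSite r) Lc) (l + 1))
        + (1 : ℝ) • fun κ u κ' u' => sgnK (trK ((unitS₂ (sfStep Lc (l + 1)) (smStep 3 Lc (l + 1)) (T2RecAt 3 Lc (toSite r) cE cVH cΛ cE₂ cB Tc vh₂S (mixFFAt (toSite r) Lc) (l + 1)))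
          κ u κ' u'))))
        - (((1 : ℝ) / 2) • (unitS₂ (sfStep Lc l) (smStep 3 Lc l) (T2RecAt 3 Lc (toSite r) cE cVH cΛ cE₂ cB Tc vh₂S (mixFFAt (toSite r) Lc) l)
        + (1 : ℝ) • fun κ u κ' u' => sgnK (trK ((unitS₂ (sfStep Lc l) (smStep 3 Lc l) (T2RecAt 3 Lc (toSite r) cE cVH cΛ cE₂ cB Tc vh₂S (mixFFAt (toSite r) Lc) l))
          κ u κ' u'))))) κ u κ' u' p z (Sum.inl β) b
        - ((((1 : ℝ) / 2) • (unitS₂ (sfStep Lc (l + 1)) (smStep 3 Lc (l + 1)) (T2RecAt 3 Lc (toSite r) cE cVH cΛ cE₂ cB Tc vh₂S (mixFFAt (toSite r) Lc) (l + 1))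
        + (1 : ℝ) • fun κ u κ' u' => sgnK (trK ((unitS₂ (sfStep Lc (l + 1)) (smStep 3 Lc (l + 1)) (T2RecAt 3 Lc (toSite r) cE cVH cΛ cE₂ cB Tc vh₂S (mixFFAt (toSite r) Lc) (l + 1)))
          κ u κ' u'))))
        - (((1 : ℝ) / 2) • (unitS₂ (sfStep Lc l) (smStep 3 Lc l) (T2RecAt 3 Lc (toSite r) cE cVH cΛ cE₂ cB Tc vh₂S (mixFFAt (toSite r) Lc) l)
        + (1 : ℝ) • fun κ u κ' u' => sgnK (trK ((unitS₂ (sfStep Lc l) (smStep 3 Lc l) (T2RecAt 3 Lc (toSite r) cE cVH cΛ cE₂ cB Tc vh₂S (mixFFAt (toSite r) Lc) l))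
          κ u κ' u'))))) κ u κ' u' (p - unitVec β) z (Sum.inl β) b)) (CL₁' * θL ^ l) δ)
    (hL₂' : ∀ l, LocStencil₂ (fun κ u κ' u' => fun (x p : Fin (3 + 1) → ℤ) (a : Fib 3) (_ : Fib 3) =>
      ∑ β : Fin (3 + 1), (((((1 : ℝ) / 2) • (unitS₂ (sfStep Lc (l + 1)) (smStep 3 Lc (l + 1)) (T2RecAt 3 Lc (toSite r) cE cVH cΛ cE₂ cB Tc vh₂S (mixFFAt (toSite r) Lc) (l + 1))
        + (1 : ℝ) • fun κ u κ' u' => sgnK (trK ((unitS₂ (sfStep Lc (l + 1)) (smStep 3 Lc (l + 1)) (T2RecAt 3 Lc (toSite r) cE cVH cΛ cE₂ cB Tc vh₂S (mixFFAt (toSite r) Lc) (l + 1)))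
          κ u κ' u'))))
        - (((1 : ℝ) / 2) • (unitS₂ (sfStep Lc l) (smStep 3 Lc l) (T2RecAt 3 Lc (toSite r) cE cVH cΛ cE₂ cB Tc vh₂S (mixFFAt (toSite r) Lc) l)
        + (1 : ℝ) • fun κ u κ' u' => sgnK (trK ((unitS₂ (sfStep Lc l) (smStep 3 Lc l) (T2RecAt 3 Lc (toSite r) cE cVH cΛ cE₂ cB Tc vh₂S (mixFFAt (toSite r) Lc) l))
          κ u κ' u'))))) κ u κ' u' x p a (Sum.inl β)
        - ((((1 : ℝ) / 2) • (unitS₂ (sfStep Lc (l + 1)) (smStep 3 Lc (l + 1)) (T2RecAt 3 Lc (toSite r) cE cVH cΛ cE₂ cB Tc vh₂S (mixFFAt (toSite r) Lc) (l + 1))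
        + (1 : ℝ) • fun κ u κ' u' => sgnK (trK ((unitS₂ (sfStep Lc (l + 1)) (smStep 3 Lc (l + 1)) (T2RecAt 3 Lc (toSite r) cE cVH cΛ cE₂ cB Tc vh₂S (mixFFAt (toSite r) Lc) (l + 1)))
          κ u κ' u'))))
        - (((1 : ℝ) / 2) • (unitS₂ (sfStep Lc l) (smStep 3 Lc l) (T2RecAt 3 Lc (toSite r) cE cVH cΛ cE₂ cB Tc vh₂S (mixFFAt (toSite r) Lc) l)
        + (1 : ℝ) • fun κ u κ' u' => sgnK (trK ((unitS₂ (sfStep Lc l) (smStep 3 Lc l) (T2RecAt 3 Lc (toSite r) cE cVH cΛ cE₂ cB Tc vh₂S (mixFFAt (toSite r) Lc) l))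
          κ u κ' u'))))) κ u κ' u' x (p - unitVec β) a (Sum.inl β))) (CL₂' * θL ^ l) δ)
    (hC : ∀ l, (∀ κ κ' κ₁ κ₂, zmode Lc (((1 : ℝ) / 2) • ((fun κ u κ' u' => (cE₂ * (Lc : ℝ) ^ (2 * (3 + 1))) • mmRead Lc (K3OfK (unitK (sfStep Lc l) (smStep 3 Lc l) (coDressKBmAt (toSite r) Lc (KInvStep (d :=
        3) Lc l))) Lc (unitS (sfStep Lc l) (smStep 3 Lc l) (SpureRecAt 3 Lc (toSite r) cE cVH cΛ l)) (unitM (sfStep Lc l) (smStep 3 Lc l) (M1At 3 Lc (toSite r) cΛ l)) (W2SymOfK (unitK (sfStep Lc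
        l) (smStep 3 Lc l) (coDressKBmAt (toSite r) Lc (KInvStep (d := 3) Lc l))) Lc (unitS (sfStep Lc l) (smStep 3 Lc l) (SpureRecAt 3 Lc (toSite r) cE cVH cΛ l)) (unitM (sfStep Lc l) (smStep 3
        Lc l) (M1At 3 Lc (toSite r) cΛ l)) 0 (unitM₂ (sfStep Lc l) (smStep 3 Lc l) (M2Of 3 Lc (mixFFAt (toSite r) Lc) l))) κ u κ' u') + cB • vh₂S κ u κ' u') + fun κ u κ' u' => sgnK (trK
        ((cE₂ * (Lc : ℝ) ^ (2 * (3 + 1))) • mmRead Lc (K3OfK (unitK (sfStep Lc l) (smStep 3 Lc l) (coDressKBmAt (toSite r) Lc (KInvStep (d := 3) Lc l))) Lc (unitS (sfStep Lc l) (smStep 3 Lc l)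
        (SpureRecAt 3 Lc (toSite r) cE cVH cΛ l)) (unitM (sfStep Lc l) (smStep 3 Lc l) (M1At 3 Lc (toSite r) cΛ l)) (W2SymOfK (unitK (sfStep Lc l) (smStep 3 Lc l) (coDressKBmAt (toSite r) Lc
        (KInvStep (d := 3) Lc l))) Lc (unitS (sfStep Lc l) (smStep 3 Lc l) (SpureRecAt 3 Lc (toSite r) cE cVH cΛ l)) (unitM (sfStep Lc l) (smStep 3 Lc l) (M1At 3 Lc (toSite r) cΛ l)) 0 (unitM₂
        (sfStep Lc l) (smStep 3 Lc l) (M2Of 3 Lc (mixFFAt (toSite r) Lc) l))) κ u κ' u') + cB • vh₂S κ u κ' u'))) + (lin4 (cE₂ * (Lc : ℝ) ^ (2 * (3 + 1))) (unitK (sfStep Lc l) (smStep 3 Lc l)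
        (coDressKBmAt (toSite r) Lc (KInvStep (d := 3) Lc l))) Lc (((1 : ℝ) / 2) • (unitS₂ (sfStep Lc l) (smStep 3 Lc l) (T2RecAt 3 Lc (toSite r) cE cVH cΛ cE₂ cB Tc vh₂S (mixFFAt (toSite r) Lc)
        l) + fun κ u κ' u' => sgnK (trK ((unitS₂ (sfStep Lc l) (smStep 3 Lc l) (T2RecAt 3 Lc (toSite r) cE cVH cΛ cE₂ cB Tc vh₂S (mixFFAt (toSite r) Lc) l)) κ u κ' u')))) - lin4 (cE₂ * (Lc :
        ℝ) ^ (2 * (3 + 1))) (unitK (sfStep Lc l) (smStep 3 Lc l) (KInvStep (d := 3) Lc l)) Lc (((1 : ℝ) / 2) • (unitS₂ (sfStep Lc l) (smStep 3 Lc l) (T2RecAt 3 Lc (toSite r) cE cVH cΛ cE₂ cB Tc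
        vh₂S (mixFFAt (toSite r) Lc) l) + fun κ u κ' u' => sgnK (trK ((unitS₂ (sfStep Lc l) (smStep 3 Lc l) (T2RecAt 3 Lc (toSite r) cE cVH cΛ cE₂ cB Tc vh₂S (mixFFAt (toSite r) Lc) l)) κ u
        κ' u')))))) κ κ' (Sum.inl κ₁) (Sum.inl κ₂) + zmode Lc (((1 : ℝ) / 2) • ((fun κ u κ' u' => (cE₂ * (Lc : ℝ) ^ (2 * (3 + 1))) • mmRead Lc (K3OfK (unitK (sfStep Lc l) (smStep 3 Lc l)
        (coDressKBmAt (toSite r) Lc (KInvStep (d := 3) Lc l))) Lc (unitS (sfStep Lc l) (smStep 3 Lc l) (SpureRecAt 3 Lc (toSite r) cE cVH cΛ l)) (unitM (sfStep Lc l) (smStep 3 Lc l) (M1At 3 Lc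
        (toSite r) cΛ l)) (W2SymOfK (unitK (sfStep Lc l) (smStep 3 Lc l) (coDressKBmAt (toSite r) Lc (KInvStep (d := 3) Lc l))) Lc (unitS (sfStep Lc l) (smStep 3 Lc l) (SpureRecAt 3 Lc (toSite
        r) cE cVH cΛ l)) (unitM (sfStep Lc l) (smStep 3 Lc l) (M1At 3 Lc (toSite r) cΛ l)) 0 (unitM₂ (sfStep Lc l) (smStep 3 Lc l) (M2Of 3 Lc (mixFFAt (toSite r) Lc) l))) κ u κ' u') + cB • vh₂S
        κ u κ' u') + fun κ u κ' u' => sgnK (trK ((cE₂ * (Lc : ℝ) ^ (2 * (3 + 1))) • mmRead Lc (K3OfK (unitK (sfStep Lc l) (smStep 3 Lc l) (coDressKBmAt (toSite r) Lc (KInvStep (d := 3) Lc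
        l))) Lc (unitS (sfStep Lc l) (smStep 3 Lc l) (SpureRecAt 3 Lc (toSite r) cE cVH cΛ l)) (unitM (sfStep Lc l) (smStep 3 Lc l) (M1At 3 Lc (toSite r) cΛ l)) (W2SymOfK (unitK (sfStep Lc l)
        (smStep 3 Lc l) (coDressKBmAt (toSite r) Lc (KInvStep (d := 3) Lc l))) Lc (unitS (sfStep Lc l) (smStep 3 Lc l) (SpureRecAt 3 Lc (toSite r) cE cVH cΛ l)) (unitM (sfStep Lc l) (smStep 3 Lc
        l) (M1At 3 Lc (toSite r) cΛ l)) 0 (unitM₂ (sfStep Lc l) (smStep 3 Lc l) (M2Of 3 Lc (mixFFAt (toSite r) Lc) l))) κ u κ' u') + cB • vh₂S κ u κ' u'))) + (lin4 (cE₂ * (Lc : ℝ) ^ (2 * (3 +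
        1))) (unitK (sfStep Lc l) (smStep 3 Lc l) (coDressKBmAt (toSite r) Lc (KInvStep (d := 3) Lc l))) Lc (((1 : ℝ) / 2) • (unitS₂ (sfStep Lc l) (smStep 3 Lc l) (T2RecAt 3 Lc (toSite r) cE cVH
        cΛ cE₂ cB Tc vh₂S (mixFFAt (toSite r) Lc) l) + fun κ u κ' u' => sgnK (trK ((unitS₂ (sfStep Lc l) (smStep 3 Lc l) (T2RecAt 3 Lc (toSite r) cE cVH cΛ cE₂ cB Tc vh₂S (mixFFAt (toSite r)
        Lc) l)) κ u κ' u')))) - lin4 (cE₂ * (Lc : ℝ) ^ (2 * (3 + 1))) (unitK (sfStep Lc l) (smStep 3 Lc l) (KInvStep (d := 3) Lc l)) Lc (((1 : ℝ) / 2) • (unitS₂ (sfStep Lc l) (smStep 3 Lc l)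
        (T2RecAt 3 Lc (toSite r) cE cVH cΛ cE₂ cB Tc vh₂S (mixFFAt (toSite r) Lc) l) + fun κ u κ' u' => sgnK (trK ((unitS₂ (sfStep Lc l) (smStep 3 Lc l) (T2RecAt 3 Lc (toSite r) cE cVH cΛ
        cE₂ cB Tc vh₂S (mixFFAt (toSite r) Lc) l)) κ u κ' u')))))) κ' κ (Sum.inl κ₁) (Sum.inl κ₂) = 0)) :
    ∃ c ϑ δ : ℝ, 0 ≤ c ∧ 0 < ϑ ∧ ϑ < 1 ∧ 0 < δ ∧
      (∀ n, LocStencil₂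
        ((((1 : ℝ) / 2) • (unitS₂ (sfStep Lc (n + 1)) (smStep 3 Lc (n + 1)) (T2RecAt 3 Lc (toSite r) cE cVH cΛ cE₂ cB Tc vh₂S (mixFFAt (toSite r) Lc) (n + 1)) + fun κ u κ' u' => sgnK (trK ((unitS₂
          (sfStep Lc (n + 1)) (smStep 3 Lc (n + 1)) (T2RecAt 3 Lc (toSite r) cE cVH cΛ cE₂ cB Tc vh₂S (mixFFAt (toSite r) Lc) (n + 1))) κ u κ' u')))) -
         (((1 : ℝ) / 2) • (unitS₂ (sfStep Lc n) (smStep 3 Lc n) (T2RecAt 3 Lc (toSite r) cE cVH cΛ cE₂ cB Tc vh₂S (mixFFAt (toSite r) Lc) n) + fun κ u κ' u' => sgnK (trK ((unitS₂ (sfStep Lc n)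
          (smStep 3 Lc n) (T2RecAt 3 Lc (toSite r) cE cVH cΛ cE₂ cB Tc vh₂S (mixFFAt (toSite r) Lc) n)) κ u κ' u'))))) (c * ϑ ^ n) δ) ∧
      (∀ k j, LocStencil₂
        ((((1 : ℝ) / 2) • (unitS₂ (sfStep Lc (k + j)) (smStep 3 Lc (k + j)) (T2RecAt 3 Lc (toSite r) cE cVH cΛ cE₂ cB Tc vh₂S (mixFFAt (toSite r) Lc) (k + j)) + fun κ u κ' u' => sgnK (trK ((unitS₂
          (sfStep Lc (k + j)) (smStep 3 Lc (k + j)) (T2RecAt 3 Lc (toSite r) cE cVH cΛ cE₂ cB Tc vh₂S (mixFFAt (toSite r) Lc) (k + j))) κ u κ' u')))) -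
         (((1 : ℝ) / 2) • (unitS₂ (sfStep Lc k) (smStep 3 Lc k) (T2RecAt 3 Lc (toSite r) cE cVH cΛ cE₂ cB Tc vh₂S (mixFFAt (toSite r) Lc) k) + fun κ u κ' u' => sgnK (trK ((unitS₂ (sfStep Lc k)
          (smStep 3 Lc k) (T2RecAt 3 Lc (toSite r) cE cVH cΛ cE₂ cB Tc vh₂S (mixFFAt (toSite r) Lc) k)) κ u κ' u'))))) (c * (1 - ϑ)⁻¹ * ϑ ^ k) δ) := by
  have h := t2DriftEven_three_of_wardLetters hLc hr cE cVH cΛ cE₂ cB hcE hpinEq Tc hBff hBmm hB hδB hBt hcH0 hcH hTL hTL'' hR hR'' hq hδ hθL0 hθL1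
    hL₁ hL₂ hL₁' hL₂' (by simpa only [one_smul] using hC)
  simpa only [one_smul] using h

end Summit.QuantumFields.BalabanUV.Beta.GAN24.T2DriftEvenMemberOfWardLetters

end
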